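import Mathlib
import Literature.Analysis.FluidPDE.VorticityEquation

/-! # Viscous Ertel identity for the pressure — crux stmt-NavierStokesRegularity-11741
(`IsobarTomography.IsobaricLinesLiouville`), line Ideator2Sketch (card flux-surface-persistence),
stub `stub_ertelIdentity`

For a classical Navier–Stokes solution (`ν = 1`, `f = 0`) on `(-∞,0) × ℝ³` with `ω = curl v`,
`Π₀ := ω·∇q` and `Dₜq := ∂ₜq + v·∇q`, the pointwise identity
`∂ₜΠ₀ + v·∇Π₀ = ω·∇(Dₜq) + Δω·∇q` (Ertel 1942; the viscous Ertel law of the pressure).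

Proof (index-free): `∂ₜΠ₀ = ⟪∂ₜω, ∇q⟫ + ⟪ω, ∂ₜ∇q⟫` and `v·∇Π₀ = ⟪Dω v, ∇q⟫ + ⟪ω, D(∇q) v⟫`
(product rules); `ω·∇(Dₜq) = D(∂ₜq) ω + ⟪Dv ω, ∇q⟫ + ⟪v, D(∇q) ω⟫`. The two Hessian terms agree
(`ContDiffAt.isSymmSndFDerivAt`), `⟪ω, ∂ₜ∇q⟫ = D(∂ₜq) ω` by the exchange of the one-sided time
derivative with spatial derivatives of the jointly smooth pressure
(`IsSmoothSpaceTimeOn.timeDerivWithin_fderiv_slice_apply`, `S = Iio 0` open), and what is left,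
`⟪∂ₜω + (v·∇)ω − (ω·∇)v, ∇q⟫ = ⟪Δω, ∇q⟫`, is the proved vorticity equation
(`IsClassicalNSSolutionOn.vorticity_eq`, `ν = 1`, `curl 0 = 0`). -/

noncomputable section

set_option linter.dupNamespace false

namespace Summit.NavierStokesRegularity.NavierStokesRegularity.Theorems.IsobaricLinesLiouville.FluxSurfacePersistence

open scoped InnerProductSpace RealInnerProductSpace ContDiff Laplacian
open Literature.Analysis.FluidPDE Set Function

/-- **Symmetry of the Hessian through the gradient**: for `f ∈ C²(ℝ³)`,
`⟪a, D(∇f)(x) b⟫ = ⟪b, D(∇f)(x) a⟫` (both sides are `D²f(x)(·)(·)`, symmetric by Schwarz,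
Mathlib's `ContDiffAt.isSymmSndFDerivAt`). -/
theorem inner_fderiv_gradient_comm {f : EuclideanSpace ℝ (Fin 3) → ℝ} (hf : ContDiff ℝ 2 f)
    (x a b : EuclideanSpace ℝ (Fin 3)) :
    ⟪a, fderiv ℝ (fun y => gradient f y) x b⟫_ℝ = ⟪b, fderiv ℝ (fun y => gradient f y) x a⟫_ℝ := by
  have hD : DifferentiableAt ℝ (fderiv ℝ f) x :=
    ((hf.fderiv_right (m := 1) (by norm_num)).differentiable one_ne_zero).differentiableAt
  have hg : DifferentiableAt ℝ (fun y => gradient f y) x := by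
    have h1 : ContDiff ℝ 1 (fun y => gradient f y) :=
      (InnerProductSpace.toDual ℝ (EuclideanSpace ℝ (Fin 3))).symm.contDiff.comp
        (hf.fderiv_right (m := 1) (by norm_num))
    exact h1.differentiable one_ne_zero x
  have key : ∀ c d : EuclideanSpace ℝ (Fin 3), ⟪c, fderiv ℝ (fun y => gradient f y) x d⟫_ℝ =
      fderiv ℝ (fderiv ℝ f) x d c := by
    intro c d
    have h1 : fderiv ℝ (fun y => ⟪c, gradient f y⟫_ℝ) x d =
        ⟪c, fderiv ℝ (fun y => gradient f y) x d⟫_ℝ := by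
      rw [fderiv_inner_apply ℝ (differentiableAt_const c) hg]
      simp
    have h2 : (fun y => ⟪c, gradient f y⟫_ℝ) = fun y => (fderiv ℝ f y) c := by
      funext y
      rw [real_inner_comm, inner_gradient_left]
    rw [← h1, h2, fderiv_clm_apply hD (differentiableAt_const c)]
    simp
  rw [key, key]
  exact (hf.contDiffAt.isSymmSndFDerivAt (by simp)) b a

/-- **Exchange of `∂ₜ` with the gradient, tested against a fixed vector**: for a jointly smooth
scalar field `q` on `S × ℝ³` (`S` of unique differentiability, `S ⊆ closure (interior S)`) and
`t ∈ S`, `⟪a, ∂ₜ(∇q)(t, x)⟫ = D(∂ₜq(t))(x) a`, where `∂ₜ = timeDerivWithin S`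
(`IsSmoothSpaceTimeOn.timeDerivWithin_fderiv_slice_apply`). -/
theorem inner_timeDerivWithin_gradient {S : Set ℝ} {q : ℝ → EuclideanSpace ℝ (Fin 3) → ℝ}
    (hq : IsSmoothSpaceTimeOn S q) (hS : UniqueDiffOn ℝ S) (hcl : S ⊆ closure (interior S))
    {t : ℝ} (ht : t ∈ S) (x a : EuclideanSpace ℝ (Fin 3)) :
    ⟪a, timeDerivWithin S (fun s y => gradient (q s) y) t x⟫_ℝ =
      fderiv ℝ (timeDerivWithin S q t) x a := by
  have hG : IsSmoothSpaceTimeOn S (fun s y => gradient (q s) y) := hq.gradient hS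
  have h1 : derivWithin (fun s => ⟪a, gradient (q s) x⟫_ℝ) S t =
      ⟪a, timeDerivWithin S (fun s y => gradient (q s) y) t x⟫_ℝ := by
    rw [((hasDerivWithinAt_const t S a).inner ℝ
      (hG.hasDerivWithinAt_timeDerivWithin hS ht x)).derivWithin (hS t ht)]
    simp
  have h2 : (fun s => ⟪a, gradient (q s) x⟫_ℝ) = fun s => fderiv ℝ (q s) x a := by
    funext s
    rw [real_inner_comm, inner_gradient_left]
  rw [← h1, h2, ← hq.timeDerivWithin_fderiv_slice_apply hS hcl ht x a, timeDerivWithin_apply]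

/-- **Viscous Ertel identity for the pressure** (Ertel 1942; Moffatt–Dormy (6.38) with `B ↦ ω`):
for a classical Navier–Stokes solution (`ν = 1`, `f = 0`) on `(-∞,0) × ℝ³` and `Π₀ := ω·∇q`,
`Dₜq := ∂ₜq + v·∇q`, one has `∂ₜΠ₀ + v·∇Π₀ = ω·∇(Dₜq) + Δω·∇q` pointwise (the two stretching terms
cancel; what is left of `(∂ₜ + v·∇ − Δ)ω = (ω·∇)v` after pairing with `∇q`). No isobaric hypothesis. -/
theorem stub_ertelIdentity :
    ∀ (v : ℝ → (EuclideanSpace ℝ (Fin 3)) → (EuclideanSpace ℝ (Fin 3))) (q : ℝ → (EuclideanSpace ℝ (Fin 3)) → ℝ), IsClassicalNSSolutionOn (Set.Iio 0) 1 0 v q →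
      ∀ t < 0, ∀ x : (EuclideanSpace ℝ (Fin 3)),
        timeDerivWithin (Set.Iio 0) (fun s y => ⟪curl (v s) y, gradient (q s) y⟫_ℝ) t x
            + ⟪v t x, gradient (fun y => ⟪curl (v t) y, gradient (q t) y⟫_ℝ) x⟫_ℝ
          = ⟪curl (v t) x,
              gradient (fun y => timeDerivWithin (Set.Iio 0) q t y + ⟪v t y, gradient (q t) y⟫_ℝ) x⟫_ℝ
            + ⟪(Δ (curl (v t))) x, gradient (q t) x⟫_ℝ := by
  intro v q h t ht x
  set S : Set ℝ := Set.Iio 0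
  -- the time set is open: unique differentiability and `S ⊆ closure (interior S)`
  have hS : UniqueDiffOn ℝ S := isOpen_Iio.uniqueDiffOn
  have hcl : S ⊆ closure (interior S) := by
    rw [isOpen_Iio.interior_eq]
    exact subset_closure
  have htS : t ∈ S := ht
  -- joint smoothness of the players
  have hv : IsSmoothSpaceTimeOn S v := h.smooth_velocity
  have hq : IsSmoothSpaceTimeOn S q := h.smooth_pressure
  have hω : IsSmoothSpaceTimeOn S (fun s y => curl (v s) y) :=
    (hv.fderiv_slice hS).clm_comp curlCLM
  have hG : IsSmoothSpaceTimeOn S (fun s y => gradient (q s) y) := hq.gradient hS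
  have hdq : IsSmoothSpaceTimeOn S (timeDerivWithin S q) := hq.timeDerivWithin hS
  -- slice regularity at the time `t`
  have hq2 : ContDiff ℝ 2 (q t) := (h.contDiff_pressure htS).of_le (by norm_cast)
  have dv : DifferentiableAt ℝ (v t) x := ((h.contDiff_velocity htS).differentiable (by simp)) x
  have dω : DifferentiableAt ℝ (fun y => curl (v t) y) x :=
    ((hω.contDiff_slice htS).differentiable (by simp)) x
  have dG : DifferentiableAt ℝ (fun y => gradient (q t) y) x :=
    ((hG.contDiff_slice htS).differentiable (by simp)) x
  have ddq : DifferentiableAt ℝ (timeDerivWithin S q t) x :=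
    ((hdq.contDiff_slice htS).differentiable (by simp)) x
  have dVG : DifferentiableAt ℝ (fun y => ⟪v t y, gradient (q t) y⟫_ℝ) x := dv.inner ℝ dG
  -- (1) `∂ₜΠ₀ = ⟪ω, ∂ₜ∇q⟫ + ⟪∂ₜω, ∇q⟫`
  have e1 : timeDerivWithin S (fun s y => ⟪curl (v s) y, gradient (q s) y⟫_ℝ) t x =
      ⟪curl (v t) x, timeDerivWithin S (fun s y => gradient (q s) y) t x⟫_ℝ +
        ⟪timeDerivWithin S (fun s y => curl (v s) y) t x, gradient (q t) x⟫_ℝ := by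
    rw [timeDerivWithin_apply]
    exact ((hω.hasDerivWithinAt_timeDerivWithin hS htS x).inner ℝ
      (hG.hasDerivWithinAt_timeDerivWithin hS htS x)).derivWithin (hS t htS)
  -- (2) `v·∇Π₀ = ⟪ω, D(∇q) v⟫ + ⟪Dω v, ∇q⟫`
  have e2 : ⟪v t x, gradient (fun y => ⟪curl (v t) y, gradient (q t) y⟫_ℝ) x⟫_ℝ =
      ⟪curl (v t) x, fderiv ℝ (fun y => gradient (q t) y) x (v t x)⟫_ℝ +
        ⟪fderiv ℝ (fun y => curl (v t) y) x (v t x), gradient (q t) x⟫_ℝ := by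
    rw [real_inner_comm, inner_gradient_left, fderiv_inner_apply ℝ dω dG]
  -- (3) `ω·∇(Dₜq) = D(∂ₜq) ω + ⟪v, D(∇q) ω⟫ + ⟪Dv ω, ∇q⟫`
  have e3 : ⟪curl (v t) x,
      gradient (fun y => timeDerivWithin S q t y + ⟪v t y, gradient (q t) y⟫_ℝ) x⟫_ℝ =
      fderiv ℝ (timeDerivWithin S q t) x (curl (v t) x) +
        (⟪v t x, fderiv ℝ (fun y => gradient (q t) y) x (curl (v t) x)⟫_ℝ +
          ⟪fderiv ℝ (v t) x (curl (v t) x), gradient (q t) x⟫_ℝ) := by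
    rw [real_inner_comm, inner_gradient_left, fderiv_fun_add ddq dVG,
      _root_.add_apply, fderiv_inner_apply ℝ dv dG]
  -- (4) exchange `⟪ω, ∂ₜ∇q⟫ = D(∂ₜq) ω`
  have e4 : ⟪curl (v t) x, timeDerivWithin S (fun s y => gradient (q s) y) t x⟫_ℝ =
      fderiv ℝ (timeDerivWithin S q t) x (curl (v t) x) :=
    inner_timeDerivWithin_gradient hq hS hcl htS x (curl (v t) x)
  -- (5) symmetry of the Hessian of `q t`
  have e5 : ⟪curl (v t) x, fderiv ℝ (fun y => gradient (q t) y) x (v t x)⟫_ℝ =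
      ⟪v t x, fderiv ℝ (fun y => gradient (q t) y) x (curl (v t) x)⟫_ℝ :=
    inner_fderiv_gradient_comm hq2 x (curl (v t) x) (v t x)
  -- (6) the vorticity equation `∂ₜω + (v·∇)ω = (ω·∇)v + Δω`, paired with `∇q`
  have e6 : timeDerivWithin S (fun s y => curl (v s) y) t x +
      fderiv ℝ (fun y => curl (v t) y) x (v t x) =
        fderiv ℝ (v t) x (curl (v t) x) + (Δ (curl (v t))) x := by
    have key := h.vorticity_eq hS hcl (fun _ _ y => curl_zero y) htS x
    rw [one_smul] at key
    exact key
  have e7 : ⟪timeDerivWithin S (fun s y => curl (v s) y) t x, gradient (q t) x⟫_ℝ +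
      ⟪fderiv ℝ (fun y => curl (v t) y) x (v t x), gradient (q t) x⟫_ℝ =
        ⟪fderiv ℝ (v t) x (curl (v t) x), gradient (q t) x⟫_ℝ +
          ⟪(Δ (curl (v t))) x, gradient (q t) x⟫_ℝ := by
    rw [← inner_add_left, e6, inner_add_left]
  -- assemble
  rw [e1, e2, e3, e4, e5]
  linarith [e7]

end Summit.NavierStokesRegularity.NavierStokesRegularity.Theorems.IsobaricLinesLiouville.FluxSurfacePersistence

end
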